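import Summits.CriticalPhenomena.PercolationContinuityZ3.Theorems.Transplant.KNCells2RootSub
import Summits.CriticalPhenomena.PercolationContinuityZ3.Theorems.Transplant.BoxProdZ2RoutesAtQ
import Summits.CriticalPhenomena.PercolationContinuityZ3.Theorems.Transplant.BoxProdZ2PrismPaths
import Summits.CriticalPhenomena.PercolationContinuityZ3.Theorems.Transplant.KNLevelsEntrance
import Summits.CriticalPhenomena.PercolationContinuityZ3.Theorems.Transplant.BoxProdZ2ConcAssemblyG
import Literature.Probability.Percolation.TreeGraphBound
import HarnessLib

/-!
# The FIRST HOP of the root run (design (D), §11 v2; residue (R), source bound `hsrc` of p2-g2's `rootOblA_concG` /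
# `rootOblA_of_rootRun`): under the root law cut to a world `U' ⊇ Q_0(0)` (the root cube WIRED), the root `(w₀, 0)` is joined to the fat
# quarter-face of the first-hop prism `frameSeq γ v (γ w₀) ℓ ⊆ U'` with probability `> 1 - δ²` — Lemma 9-prod at the running parameter
# (`link_frameSeq_center_of_leQ`, weights `≥ q` on the prism), the seed prism inside the wired cube, and the cube's internal connectivity

builds on p205010 (kernel theorem, internal audit signed; external expert review pending) — nothing in this file uses p205010.
Lane `prim-bschramm`, seat `prim-bschramm-p3` (residue (R) first hop, V56); helper file (`--supports stmt-CriticalPhenomena-4575 --as helper`).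

* `pathIn_rootCube` — the root cube `B(w₀, rQ a 0) × C.Q 0` is internally connected from `(w₀, 0)`;
* `W0sub_ge_of_mem` — inside `U'` the cut root law is `≥ q` on edges (`= 1` on the cube's edges);
* `W0sub_ae_open_rootCube` — the cube's edges are a.s. open;
* **`root_hsrc`** — `1 - δ² < P_{W0sub U'}(⋃_{t ∈ fat face} {(w₀,0) ↔ t})`;
* §2 **`wired_prism_hsrc`** — the same from a wired kit prism under any law (the inner elongated routes);
* §3 `fatFace_image_eq`, **`root_hsrc'`**, **`wired_prism_hsrc'`** — product forms `B(c, ψ ℓ) × (v + F)` of the landing faces.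
[cite: KozmaNitzan2024, §4 p. 27 (G₀: the wired cube), p. 28 ((32) at the root), Lemma 9 (p. 16)]
-/

noncomputable section

open MeasureTheory

namespace Summit.CriticalPhenomena.PercolationContinuityZ3.Theorems

namespace Transplant

namespace BoxProdZ2

open Literature.Probability.Percolation Literature.Probability.LatticeModels SimpleGraph KNLevels KNCells GadgetSystem Contour
open Literature.Probability.Percolation.KozmaNitzan
open Literature.Probability.Percolation.GM
open Literature.Barriers.CriticalPhenomena (graphBall graphBall_finite mem_graphBall_self graphBall_mono)
open scoped Classical

variable {W : Type} [DecidableEq W] [Countable W] (X : SimpleGraph W) [X.LocallyFinite]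
variable (C : PCells) (w₀ : W) (Λ : ConcRadiiG)

omit [Countable W] in
/-- **The root cube is internally connected from the root.** [cite: KozmaNitzan2024, §4 p. 27 (G₀)] -/
theorem pathIn_rootCube (a : ℕ) {s : W × Site 2} (hs : s ∈ (cellGeomCG X C w₀ Λ).Q a 0) :
    PathIn (X □ zdGraph 2) (↑((cellGeomCG X C w₀ Λ).Q a 0) : Set (W × Site 2)) (w₀, 0) s := by
  change s ∈ ballFin X w₀ (Λ.rQ a 0) ×ˢ C.Q 0 at hs
  change PathIn (X □ zdGraph 2) (↑(ballFin X w₀ (Λ.rQ a 0) ×ˢ C.Q 0) : Set (W × Site 2)) (w₀, 0) s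
  obtain ⟨h1, h2⟩ := Finset.mem_product.1 hs
  have hw₀ : w₀ ∈ ballFin X w₀ (Λ.rQ a 0) := (mem_ballFin X).2 (mem_graphBall_self X w₀ _)
  have hA : PathIn (zdGraph 2) (↑(C.Q 0) : Set (Site 2)) 0 s.2 := by
    rw [PCells.Q]; exact KozmaNitzan.exists_pathIn_Icc (by rw [← PCells.Q]; exact C.zero_mem_Q_zero) h2
  exact (pathIn_prod_right X hA hw₀).trans (pathIn_prod_left X (pathIn_ballFin_center X w₀ _ ((mem_ballFin X).1 h1)) h2)

variable {C w₀ Λ} {q : unitInterval} {δc : ℝ}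

omit [Countable W] in
/-- Inside `U'` the cut root law gives every edge weight `≥ q` (`1` on the root cube's edges, `q` elsewhere). [folklore] -/
theorem W0sub_ge_of_mem {U' : Finset (W × Site 2)} {u u' : W × Site 2} (hu : u ∈ U') (hu' : u' ∈ U') (hadj : (X □ zdGraph 2).Adj u u') :
    q ≤ (concSchemeG X C w₀ Λ q δc).W0sub (X □ zdGraph 2) U' s(u, u') := by
  have hxU : s(u, u') ∈ wireSet (↑U' : Set (W × Site 2)) := mk_mem_wireSet_iff.2 ⟨Finset.mem_coe.2 hu, Finset.mem_coe.2 hu', hadj.ne⟩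
  by_cases hF : s(u, u') ∈ (concSchemeG X C w₀ Λ q δc).U₀ (X □ zdGraph 2)
  · unfold KSchA.W0sub
    rw [restrW_apply_of_mem _ hxU, pinW_apply_of_mem_of_mem _ (Finset.mem_coe.2 hF) (Finset.mem_coe.2 hF)]
    exact unitInterval.le_one _
  · rw [KSchA.W0sub_apply_of_mem hxU hF, lattW_mk_of_adj _ _ hadj]

/-- **The root cube's edges are a.s. open** under the cut root law (`Q_0(0) ⊆ U'`). [cite: KozmaNitzan2024, §4 p. 27 (G₀)] -/
theorem W0sub_ae_open_rootCube {U' : Finset (W × Site 2)} (hQU : (cellGeomCG X C w₀ Λ).Q 0 0 ⊆ U') :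
    ∀ᵐ ω ∂prodBernoulli ((concSchemeG X C w₀ Λ q δc).W0sub (X □ zdGraph 2) U'),
      ∀ c d, c ∈ (↑((cellGeomCG X C w₀ Λ).Q 0 0) : Set (W × Site 2)) → d ∈ (↑((cellGeomCG X C w₀ Λ).Q 0 0) : Set (W × Site 2)) →
        (X □ zdGraph 2).Adj c d → s(c, d) ∈ ω := by
  have key : ∀ e' : Sym2 (W × Site 2), ∀ᵐ ω ∂prodBernoulli ((concSchemeG X C w₀ Λ q δc).W0sub (X □ zdGraph 2) U'),
      e' ∈ (concSchemeG X C w₀ Λ q δc).U₀ (X □ zdGraph 2) → e' ∈ ω := by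
    intro e'
    by_cases he : e' ∈ (concSchemeG X C w₀ Λ q δc).U₀ (X □ zdGraph 2)
    · have h1 : (concSchemeG X C w₀ Λ q δc).W0sub (X □ zdGraph 2) U' e' = 1 := by
        have he' := he
        unfold KSchA.U₀ at he'
        obtain ⟨hedge, hends⟩ := mem_edgesIn_iff.1 he'
        have hxU : e' ∈ wireSet (↑U' : Set (W × Site 2)) := by
          induction e' using Sym2.ind with
          | h x y =>
            exact mk_mem_wireSet_iff.2 ⟨Finset.mem_coe.2 (hQU (hends x (Sym2.mem_mk_left _ _))),
              Finset.mem_coe.2 (hQU (hends y (Sym2.mem_mk_right _ _))), ((SimpleGraph.mem_edgeSet _).1 hedge).ne⟩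
        unfold KSchA.W0sub
        rw [restrW_apply_of_mem _ hxU, pinW_apply_of_mem_of_mem _ (Finset.mem_coe.2 he) (Finset.mem_coe.2 he)]
      filter_upwards [prodBernoulli_ae_mem_of_eq_one _ h1] with ω hω _ using hω
    · exact Filter.Eventually.of_forall fun ω h' => absurd h' he
  rw [← ae_all_iff] at key
  · filter_upwards [key] with ω hω c d hc hd hcd
    refine hω _ ?_
    unfold KSchA.U₀
    exact mem_edgesIn_iff.2 ⟨(SimpleGraph.mem_edgeSet _).2 hcd, fun x hx => by
      rcases Sym2.mem_iff.1 hx with rfl | rfl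
      · exact Finset.mem_coe.1 hc
      · exact Finset.mem_coe.1 hd⟩

omit [Countable W] in
/-- Monotonicity of the real-valued measure along an a.s. inclusion. [folklore] -/
private theorem measureReal_mono_ae' {α : Type*} [MeasurableSpace α] {μ : Measure α} [IsFiniteMeasure μ] {s t : Set α}
    (h : ∀ᵐ x ∂μ, x ∈ s → x ∈ t) : μ.real s ≤ μ.real t := by
  rw [measureReal_def, measureReal_def]
  exact ENNReal.toReal_mono (measure_ne_top _ _) (measure_mono_ae h)

/-- **The first hop of the root run.**  Under the cut root law `W0sub U'` with the root cube inside `U'`, a frame `γ` at the root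
(`γ w₀ ∈ V₀`), the seed prism `frameSeq γ v (γ w₀) (msel (γ w₀))` inside the root cube and the first-hop prism `frameSeq γ v (γ w₀) ℓ ⊆ U'`,
the link input at scale `ℓ` at the running parameter gives `1 - δ² < P(⋃_{t ∈ fat quarter-face} (w₀, 0) ↔ t)`.
[cite: KozmaNitzan2024, §4 p. 28 ((32) at the root), Lemma 9 (p. 16)] -/
theorem root_hsrc {p₀ : unitInterval} (hT : TubeSubcritical X p₀) (V₀ : Finset W) {δ : ℝ} {msel : W → ℕ} {ℓ : ℕ}
    (hlink : ∀ τ ∈ V₀, ∀ g : HOct 2, 1 - δ ^ 2 < (bondPercolation (X □ zdGraph 2) q).real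
      (linkIn (↑(ufatSeq X hT V₀ τ ℓ)) (ufatSeq X hT V₀ τ (msel τ)) (ballFin X τ (ufatRadius X hT V₀ ℓ) ×ˢ piece g ℓ)))
    {U' : Finset (W × Site 2)} (hQU : (cellGeomCG X C w₀ Λ).Q 0 0 ⊆ U') (γ : X ≃g X) (hγ : γ w₀ ∈ V₀) (v : Site 2)
    (hin : frameSeq X hT V₀ γ v (γ w₀) (msel (γ w₀)) ⊆ (cellGeomCG X C w₀ Λ).Q 0 0) (hℓU : frameSeq X hT V₀ γ v (γ w₀) ℓ ⊆ U')
    (a : Fin 2) (τ' : Fin 2 → ℤˣ) :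
    1 - δ ^ 2 < (prodBernoulli ((concSchemeG X C w₀ Λ q δc).W0sub (X □ zdGraph 2) U')).real
      (⋃ t ∈ (ballFin X (γ w₀) (ufatRadius X hT V₀ ℓ) ×ˢ orthantFace a τ' ℓ).image (prodFrameIso X γ.symm v), openConn ((w₀, (0 : Site 2)) : W × Site 2) t) := by
  set μ := prodBernoulli ((concSchemeG X C w₀ Λ q δc).W0sub (X □ zdGraph 2) U') with hμ
  set F := (ballFin X (γ w₀) (ufatRadius X hT V₀ ℓ) ×ˢ orthantFace a τ' ℓ).image (prodFrameIso X γ.symm v) with hF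
  -- Lemma 9-prod under the cut root law
  have h1 := link_frameSeq_center_of_leQ X hT V₀ hlink (Wt := (concSchemeG X C w₀ Λ q δc).W0sub (X □ zdGraph 2) U') γ hγ v
    (fun u hu u' hu' hadj => W0sub_ge_of_mem X (hℓU hu) (hℓU hu') hadj) a τ'
  refine lt_of_lt_of_le h1 (measureReal_mono_ae' ?_)
  filter_upwards [W0sub_ae_open_rootCube X (q := q) (δc := δc) hQU] with ω hopen hω
  -- from the seed prism to the wired root cube containing the root
  have hω' : ω ∈ linkIn (↑U' : Set (W × Site 2)) ((cellGeomCG X C w₀ Λ).Q 0 0) F :=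
    linkIn_mono (Finset.coe_subset.2 hℓU) hin le_rfl hω
  have h2 := linkIn_subset_biUnion_openConnIn_of_wired (G := X □ zdGraph 2) (Finset.coe_subset.2 hQU) (o := (w₀, 0))
    (fun s hs => by simpa [γ.symm_apply_apply] using pathIn_rootCube X C w₀ Λ 0 hs) hopen hω'
  simp only [Set.mem_iUnion, exists_prop] at h2 ⊢
  obtain ⟨t, ht, h3⟩ := h2
  exact ⟨t, ht, openConnIn_subset_openConn _ _ _ h3⟩

/-! ## §2 The first hop from a WIRED PRISM under any law (the inner elongated routes)

For the inner straight run of a face-step route the source is the kit prism `S = frameSeq γ v (γ c) (msel (γ c))` wired open under the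
route law `W'` (p2-g2's `advRoute_of_contact`): if `W'` gives weight `1` to the edges inside `S` and weight `≥ q` to the edges of the
first-hop prism `frameSeq γ v (γ c) ℓ`, the centre `(c, v)` is joined to the fat quarter-face with probability `> 1 - δ²`. -/

/-- **The first hop from a wired prism.** [cite: KozmaNitzan2024, §4 Lemma 9 (p. 16), Lemma 11 (p. 22)] -/
theorem wired_prism_hsrc {p₀ : unitInterval} (hT : TubeSubcritical X p₀) (V₀ : Finset W) {δ : ℝ} {msel : W → ℕ} {ℓ : ℕ}
    (hlink : ∀ τ ∈ V₀, ∀ g : HOct 2, 1 - δ ^ 2 < (bondPercolation (X □ zdGraph 2) q).real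
      (linkIn (↑(ufatSeq X hT V₀ τ ℓ)) (ufatSeq X hT V₀ τ (msel τ)) (ballFin X τ (ufatRadius X hT V₀ ℓ) ×ˢ piece g ℓ)))
    (hmℓ : msel ≤ fun _ => ℓ) {W' : Sym2 (W × Site 2) → unitInterval} {c : W} (γ : X ≃g X) (hγ : γ c ∈ V₀) (v : Site 2)
    (hge : ∀ u ∈ frameSeq X hT V₀ γ v (γ c) ℓ, ∀ u' ∈ frameSeq X hT V₀ γ v (γ c) ℓ, (X □ zdGraph 2).Adj u u' → q ≤ W' s(u, u'))
    (hone : ∀ u ∈ frameSeq X hT V₀ γ v (γ c) (msel (γ c)), ∀ u' ∈ frameSeq X hT V₀ γ v (γ c) (msel (γ c)),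
      (X □ zdGraph 2).Adj u u' → W' s(u, u') = 1)
    (a : Fin 2) (τ' : Fin 2 → ℤˣ) :
    1 - δ ^ 2 < (prodBernoulli W').real
      (⋃ t ∈ (ballFin X (γ c) (ufatRadius X hT V₀ ℓ) ×ˢ orthantFace a τ' ℓ).image (prodFrameIso X γ.symm v), openConn ((c, v) : W × Site 2) t) := by
  set S := frameSeq X hT V₀ γ v (γ c) (msel (γ c)) with hSdef
  set F := (ballFin X (γ c) (ufatRadius X hT V₀ ℓ) ×ˢ orthantFace a τ' ℓ).image (prodFrameIso X γ.symm v) with hF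
  have h1 := link_frameSeq_center_of_leQ X hT V₀ hlink (Wt := W') γ hγ v hge a τ'
  -- the wired prism's edges are a.s. open
  have hae : ∀ᵐ ω ∂prodBernoulli W', ∀ u u', u ∈ (↑S : Set (W × Site 2)) → u' ∈ (↑S : Set (W × Site 2)) →
      (X □ zdGraph 2).Adj u u' → s(u, u') ∈ ω := by
    have key : ∀ e' : Sym2 (W × Site 2), ∀ᵐ ω ∂prodBernoulli W', W' e' = 1 → e' ∈ ω := by
      intro e'
      by_cases he : W' e' = 1
      · filter_upwards [prodBernoulli_ae_mem_of_eq_one _ he] with ω hω _ using hω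
      · exact Filter.Eventually.of_forall fun ω h' => absurd h' he
    rw [← ae_all_iff] at key
    filter_upwards [key] with ω hω u u' hu hu' hadj
    exact hω _ (hone u (Finset.mem_coe.1 hu) u' (Finset.mem_coe.1 hu') hadj)
  refine lt_of_lt_of_le h1 (measureReal_mono_ae' ?_)
  filter_upwards [hae] with ω hopen hω
  have hSU : (↑S : Set (W × Site 2)) ⊆ ↑(frameSeq X hT V₀ γ v (γ c) ℓ) :=
    Finset.coe_subset.2 (frameSeq_mono X hT V₀ γ v (γ c) (hmℓ (γ c)))
  have h2 := linkIn_subset_biUnion_openConnIn_of_wired (G := X □ zdGraph 2) hSU (o := (c, v))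
    (fun s hs => by simpa [γ.symm_apply_apply] using pathIn_frameSeq X hT V₀ γ v (γ c) (msel (γ c)) hs) hopen hω
  simp only [Set.mem_iUnion, exists_prop] at h2 ⊢
  obtain ⟨t, ht, h3⟩ := h2
  exact ⟨t, ht, openConnIn_subset_openConn _ _ _ h3⟩

/-! ## §3 Product form of the landing faces -/

/-- The fat quarter-face of the frame prism is the product `B(c, ψ ℓ) × (v + F)`. [folklore] -/
theorem fatFace_image_eq {p₀ : unitInterval} (hT : TubeSubcritical X p₀) (V₀ : Finset W) (γ : X ≃g X) (c : W) (v : Site 2) (ℓ : ℕ)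
    (a : Fin 2) (τ' : Fin 2 → ℤˣ) :
    (ballFin X (γ c) (ufatRadius X hT V₀ ℓ) ×ˢ orthantFace a τ' ℓ).image (prodFrameIso X γ.symm v) =
      ballFin X c (ufatRadius X hT V₀ ℓ) ×ˢ (orthantFace a τ' ℓ).image (fun t => t + v) := by
  rw [image_prodFrameIso_product, image_ballFin_iso, γ.symm_apply_apply]

/-- **The first hop of the root run, product form**: `1 - δ² < P_{W0sub U'}(⋃_{t ∈ B(w₀, ψ ℓ) × (v + F)} (w₀,0) ↔ t)` — the `hsrc` of p2-g2's
`rootOblA_of_rootRun` with `B₀ := ballFin X w₀ (ψ ℓ) ×ˢ (orthantFace a τ' ℓ).image (· + v)`. [cite: KozmaNitzan2024, §4 p. 28 ((32) at the root)] -/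
theorem root_hsrc' {p₀ : unitInterval} (hT : TubeSubcritical X p₀) (V₀ : Finset W) {δ : ℝ} {msel : W → ℕ} {ℓ : ℕ}
    (hlink : ∀ τ ∈ V₀, ∀ g : HOct 2, 1 - δ ^ 2 < (bondPercolation (X □ zdGraph 2) q).real
      (linkIn (↑(ufatSeq X hT V₀ τ ℓ)) (ufatSeq X hT V₀ τ (msel τ)) (ballFin X τ (ufatRadius X hT V₀ ℓ) ×ˢ piece g ℓ)))
    {U' : Finset (W × Site 2)} (hQU : (cellGeomCG X C w₀ Λ).Q 0 0 ⊆ U') (γ : X ≃g X) (hγ : γ w₀ ∈ V₀) (v : Site 2)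
    (hin : frameSeq X hT V₀ γ v (γ w₀) (msel (γ w₀)) ⊆ (cellGeomCG X C w₀ Λ).Q 0 0) (hℓU : frameSeq X hT V₀ γ v (γ w₀) ℓ ⊆ U')
    (a : Fin 2) (τ' : Fin 2 → ℤˣ) :
    1 - δ ^ 2 < (prodBernoulli ((concSchemeG X C w₀ Λ q δc).W0sub (X □ zdGraph 2) U')).real
      (⋃ t ∈ ballFin X w₀ (ufatRadius X hT V₀ ℓ) ×ˢ (orthantFace a τ' ℓ).image (fun t => t + v), openConn ((w₀, (0 : Site 2)) : W × Site 2) t) := by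
  rw [← fatFace_image_eq X hT V₀ γ w₀ v ℓ a τ']
  exact root_hsrc X hT V₀ hlink hQU γ hγ v hin hℓU a τ'

/-- **The first hop from a wired prism, product form.** [cite: KozmaNitzan2024, §4 Lemma 11 (p. 22)] -/
theorem wired_prism_hsrc' {p₀ : unitInterval} (hT : TubeSubcritical X p₀) (V₀ : Finset W) {δ : ℝ} {msel : W → ℕ} {ℓ : ℕ}
    (hlink : ∀ τ ∈ V₀, ∀ g : HOct 2, 1 - δ ^ 2 < (bondPercolation (X □ zdGraph 2) q).real
      (linkIn (↑(ufatSeq X hT V₀ τ ℓ)) (ufatSeq X hT V₀ τ (msel τ)) (ballFin X τ (ufatRadius X hT V₀ ℓ) ×ˢ piece g ℓ)))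
    (hmℓ : msel ≤ fun _ => ℓ) {W' : Sym2 (W × Site 2) → unitInterval} {c : W} (γ : X ≃g X) (hγ : γ c ∈ V₀) (v : Site 2)
    (hge : ∀ u ∈ frameSeq X hT V₀ γ v (γ c) ℓ, ∀ u' ∈ frameSeq X hT V₀ γ v (γ c) ℓ, (X □ zdGraph 2).Adj u u' → q ≤ W' s(u, u'))
    (hone : ∀ u ∈ frameSeq X hT V₀ γ v (γ c) (msel (γ c)), ∀ u' ∈ frameSeq X hT V₀ γ v (γ c) (msel (γ c)),
      (X □ zdGraph 2).Adj u u' → W' s(u, u') = 1)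
    (a : Fin 2) (τ' : Fin 2 → ℤˣ) :
    1 - δ ^ 2 < (prodBernoulli W').real
      (⋃ t ∈ ballFin X c (ufatRadius X hT V₀ ℓ) ×ˢ (orthantFace a τ' ℓ).image (fun t => t + v), openConn ((c, v) : W × Site 2) t) := by
  rw [← fatFace_image_eq X hT V₀ γ c v ℓ a τ']
  exact wired_prism_hsrc X hT V₀ hlink hmℓ γ hγ v hge hone a τ'

end BoxProdZ2

end Transplant

end Summit.CriticalPhenomena.PercolationContinuityZ3.Theorems

end
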